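/-
Origin: expansion seat `planner-pub-hodgecm-mc-axioms-1-g14-0`, handover #W163 2026-08-20T15:53:55Z md5 0ad803bbbb4d (PKG 9f80e0d2ea40 → 0ad803bbbb4d; 233 l.; MECHANICAL (iib-R) rewrite v3.1 of the PKG file as it stands (6 token edits; rules R3x6)) (`HOME/mc/pub-hodgecm-mc-axioms-1-g14/revendor/kit-r55/stage55/HodgeCM/Model/LevelCovering.lean`, md5 0ad803bbbb4d, 233 lines);
landed by the gen-22 packager (p-g22) in gate run 55 REPLACES the earlier landed copy of `HodgeCM/Model/LevelCovering.lean` (seat copy carried the packager Origin header of an earlier run (stripped)).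
-/
/-
Unit pub-hodgecm-mc-glue-1-g2 (node E, vacancy (ii-cov) KERNEL half). NEW additive leaf `HodgeCM/Model/LevelCovering.lean`
(package-native; imports the vendored twins of `UnitaryBallLocalBiholomorphy` and `AnalytificationMorphisms` only).
KERNEL throughout: the record `Arapura2012_Cor_15_4_6` enters as the HYPOTHESIS of the last theorem, nothing is cited.
Expected `#print axioms`: {propext, Classical.choice, Quot.sound}.  (A byte-for-byte tree twin of this file, in the
namespace `Literature.AlgebraicGeometry.ShimuraVarieties.UnitaryBallUniformisationDatum`, is parked in the seat's scratch
`mc/pub-hodgecm-mc-glue-1-g2/tree/` for a seat with gate duty; this package copy lives in `HodgeCM.Model.LevelCovering`.)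
-/
import Literature.AlgebraicGeometry.ShimuraVarieties.UnitaryBallLocalBiholomorphy
import Literature.NumberTheory.Transcendental.AnalytificationMorphisms

/-!
# Level coverings of compact ball quotients are holomorphic, hence morphisms of the models

Let `D₁ : UnitaryBallUniformisationDatum 2 X₁` and `D₂ : UnitaryBallUniformisationDatum 2 X₂` be two ball
uniformizations `Γ₁\𝔹² ≅ X₁(ℂ)`, `Γ₂\𝔹² ≅ X₂(ℂ)` of smooth projective surfaces with THE SAME complex
hermitian space (`D₁.Hℂ = D₂.Hℂ`, so the same negative cone and the same ball) and `Γ₁ ≤ Γ₂` read in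
`GL₃(ℂ)` (`D₁.Γ^{τ₁} ≤ D₂.Γ^{τ₁}`) — the situation of a LEVEL COVERING `Γ₁\𝔹² → Γ₂\𝔹²`. We prove:

* `unif_eq_unif_of_level` — `unif₂` is constant on the fibres of `unif₁` (the fibres are the
  `Γᵢ·ℂˣ`-orbits, field `unif_eq_unif_iff`), so
* `levelPts D₁ D₂ : X₁(ℂ) → X₂(ℂ)`, `unif₁ v ↦ unif₂ v` (`levelPts_unif`), is well defined, and read in
  Hodge models `A₁`, `A₂` (the complex manifolds `X₁^an`, `X₂^an`) it is the map
  `levelMap D₁ D₂ A₁ A₂ : X₁^an → X₂^an` with `levelMap ∘ ψ₁ = ψ₂` on the ball for the uniformizations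
  `ψᵢ = Dᵢ.modelUnif Aᵢ 𝔣` in a common Sylvester frame (`levelMap_modelUnif`);
* `mdifferentiable_levelMap` — `levelMap` is HOLOMORPHIC: near any point, `ψ₁` has a holomorphic
  local inverse `g` in the chart (`UnitaryBallLocalBiholomorphy.ChartInverse`), and there
  `levelMap = ψ₂ ∘ g ∘ (chart)`, a composite of holomorphic maps (`unifHolomorphic`);
* `exists_hom_map_unif_eq` — under the record `Arapura2012_Cor_15_4_6` ("a holomorphic map between
  nonsingular projective algebraic varieties is a morphism of varieties", applied to the two
  analytifications `Aᵢ.isAnalytification`), there is a morphism `g : X₁ ⟶ X₂` of `ℂ`-schemes with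
  `g(ℂ) (unif₁ v) = unif₂ v` on the cone: the level covering is a morphism of the algebraic models.

All statements are theorems (the record enters only as the hypothesis of the last one).

References: N. Bergeron, J. Millson, C. Moeglin, Acta Math. 216 (2016), Introduction §1.1 (the tower
of congruence ball quotients `S(Γ)`); D. Arapura, *Algebraic Geometry over the Complex Numbers*
(2012), §15.4 Cor. 15.4.6; K. Fritzsche, H. Grauert, *From Holomorphic Functions to Complex Manifolds*
(2002), Ch. I §8 (local biholomorphisms).

## Provenance

Written for the pub-hodgecm formalisation cell (model-construction sub-cell, seat mc-glue-1 gen 2,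
MODEL-DAG node E / vacancy (ii-cov), kernel half: the `cover` field of the adelic theta core), over the
vendored H21 tree modules it imports. Nothing in this file is a claim of the manuscripts adjudicated by
that cell.
-/

noncomputable section

open Matrix Function Set Filter
open scoped Manifold Topology
open Literature.Geometry.ComplexHyperbolic
open Literature.Geometry.ComplexHyperbolic.BallModel (Ball)
open Literature.NumberTheory.Transcendental
open Literature.AlgebraicGeometry.HodgeTheory (HodgeModel)
open Literature.AlgebraicGeometry.Motives (SchemeOver ComplexPoints AlgPoints)
open CategoryTheory

namespace HodgeCM.Model.LevelCovering

open Literature.AlgebraicGeometry.ShimuraVarieties UnitaryBallUniformisationDatum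

variable {X₁ X₂ : SchemeOver ℂ} {D₁ : UnitaryBallUniformisationDatum 2 X₁} {D₂ : UnitaryBallUniformisationDatum 2 X₂}

/-! ### The point-level covering `unif₁ v ↦ unif₂ v` -/

/-- Same complex hermitian space, same negative cone. [folklore] -/
theorem cone_eq_of_Hℂ_eq (hH : D₁.Hℂ = D₂.Hℂ) : D₁.cone = D₂.cone := by
  change negCone D₁.Hℂ = negCone D₂.Hℂ
  rw [hH]

/-- **`unif₂` is constant on the fibres of `unif₁`** for a level pair `Γ₁^{τ₁} ≤ Γ₂^{τ₁}` with the same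
hermitian space: the fibres of `unifᵢ` on the cone are the `Γᵢ·ℂˣ`-orbits.
[cite: BergeronMillsonMoeglin2016Balls, Introduction §1.1] -/
theorem unif_eq_unif_of_level (hH : D₁.Hℂ = D₂.Hℂ)
    (hΓ : D₁.Γ.map (Matrix.GeneralLinearGroup.map D₁.τ₁) ≤
      D₂.Γ.map (Matrix.GeneralLinearGroup.map D₂.τ₁))
    {v w : Fin 3 → ℂ} (hv : v ∈ D₁.cone) (hw : w ∈ D₁.cone) (h : D₁.unif v = D₁.unif w) :
    D₂.unif v = D₂.unif w := by
  obtain ⟨γ, hγ, c, hc, hγv⟩ := (D₁.unif_eq_unif_iff v hv w hw).1 h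
  have hmem : Matrix.GeneralLinearGroup.map D₁.τ₁ γ ∈
      D₂.Γ.map (Matrix.GeneralLinearGroup.map D₂.τ₁) :=
    hΓ (Subgroup.mem_map_of_mem _ hγ)
  obtain ⟨γ₂, hγ₂, hγeq⟩ := Subgroup.mem_map.1 hmem
  have hv₂ : v ∈ D₂.cone := cone_eq_of_Hℂ_eq hH ▸ hv
  have hw₂ : w ∈ D₂.cone := cone_eq_of_Hℂ_eq hH ▸ hw
  refine (D₂.unif_eq_unif_iff v hv₂ w hw₂).2 ⟨γ₂, hγ₂, c, hc, ?_⟩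
  have hmat := congrArg (fun g : GL (Fin 3) ℂ ↦ (g : Matrix (Fin 3) (Fin 3) ℂ)) hγeq
  simp only [coe_generalLinearGroup_map] at hmat
  rw [hmat]
  exact hγv

variable (D₁) in
/-- A cone vector over a complex point (a choice; `unif` is onto, field `surjOn_unif`). [folklore] -/
def coneSec (P : ComplexPoints X₁) : Fin 3 → ℂ :=
  (D₁.surjOn_unif (mem_univ P)).choose

/-- The chosen vector lies in the cone. [folklore] -/
theorem coneSec_mem (P : ComplexPoints X₁) : coneSec D₁ P ∈ D₁.cone :=
  (D₁.surjOn_unif (mem_univ P)).choose_spec.1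

/-- The chosen vector lies over the point. [folklore] -/
theorem unif_coneSec (P : ComplexPoints X₁) : D₁.unif (coneSec D₁ P) = P :=
  (D₁.surjOn_unif (mem_univ P)).choose_spec.2

variable (D₁ D₂) in
/-- **The level covering on complex points** `X₁(ℂ) → X₂(ℂ)`, `P ↦ unif₂ (any cone vector over P)`.
[cite: BergeronMillsonMoeglin2016Balls, Introduction §1.1] -/
def levelPts (P : ComplexPoints X₁) : ComplexPoints X₂ :=
  D₂.unif (coneSec D₁ P)

/-- `levelPts (unif₁ v) = unif₂ v` on the cone. [cite: BergeronMillsonMoeglin2016Balls, Introduction §1.1] -/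
theorem levelPts_unif (hH : D₁.Hℂ = D₂.Hℂ)
    (hΓ : D₁.Γ.map (Matrix.GeneralLinearGroup.map D₁.τ₁) ≤
      D₂.Γ.map (Matrix.GeneralLinearGroup.map D₂.τ₁))
    {v : Fin 3 → ℂ} (hv : v ∈ D₁.cone) : levelPts D₁ D₂ (D₁.unif v) = D₂.unif v :=
  unif_eq_unif_of_level hH hΓ (coneSec_mem _) hv (unif_coneSec _)

/-! ### The covering read in Hodge models -/

variable (D₁ D₂) in
/-- **The level covering of the analytifications** `X₁^an → X₂^an` (Hodge models `A₁`, `A₂`):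
`levelPts` conjugated by the homeomorphisms `Xᵢ^an ≃ₜ Xᵢ(ℂ)`.
[cite: BergeronMillsonMoeglin2016Balls, Introduction §1.1] [cite: SerreGAGA1956, §2] -/
def levelMap (A₁ : HodgeModel 2 X₁) (A₂ : HodgeModel 2 X₂) (x : A₁.carrier) : A₂.carrier :=
  A₂.isAnalytification.homeomorph.symm (levelPts D₁ D₂ (A₁.toComplexPoints x))

variable {A₁ : HodgeModel 2 X₁} {A₂ : HodgeModel 2 X₂}

/-- `levelMap` lies over `levelPts`. [folklore] -/
theorem toComplexPoints_levelMap (x : A₁.carrier) :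
    A₂.toComplexPoints (levelMap D₁ D₂ A₁ A₂ x) = levelPts D₁ D₂ (A₁.toComplexPoints x) :=
  A₂.isAnalytification.homeomorph.apply_symm_apply _

variable (D₁) in
/-- A Sylvester frame of `D₂` is one of `D₁` (same complex Gram matrix). [folklore] -/
def frameTransfer (hH : D₁.Hℂ = D₂.Hℂ) (𝔣 : D₂.SylvesterFrame) : D₁.SylvesterFrame :=
  ⟨𝔣.T, by rw [hH]; exact 𝔣.conjTranspose_mul_mul⟩

/-- The transferred frame has the same matrix. [folklore] -/
@[simp] theorem frameTransfer_T (hH : D₁.Hℂ = D₂.Hℂ) (𝔣 : D₂.SylvesterFrame) :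
    (frameTransfer D₁ hH 𝔣).T = 𝔣.T := rfl

/-- **`levelMap ∘ ψ₁ = ψ₂` on the ball**, for the uniformizations read in a common frame.
[cite: BergeronMillsonMoeglin2016Balls, Introduction §1.1] -/
theorem levelMap_modelUnif (hH : D₁.Hℂ = D₂.Hℂ)
    (hΓ : D₁.Γ.map (Matrix.GeneralLinearGroup.map D₁.τ₁) ≤
      D₂.Γ.map (Matrix.GeneralLinearGroup.map D₂.τ₁))
    (𝔣 : D₂.SylvesterFrame) (z : Ball) :
    levelMap D₁ D₂ A₁ A₂ (D₁.modelUnif A₁ (frameTransfer D₁ hH 𝔣) z.1) = D₂.modelUnif A₂ 𝔣 z.1 := by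
  unfold levelMap
  rw [toComplexPoints_modelUnif, ballUnifMap_apply, levelPts_unif hH hΓ (D₁.coneLift _ z).2]
  rfl

/-- **The level covering is holomorphic.** Near `x = ψ₁ z`, with `g` a holomorphic local inverse of
`ψ₁` in the chart `c` at `x` (`ChartInverse`: `c⁻¹ = ψ₁ ∘ g`), `levelMap = ψ₂ ∘ g ∘ c`, a composite of
holomorphic maps. [cite: FritzscheGrauert2002, Ch. I §8 Cor. 8.6]
[cite: BergeronMillsonMoeglin2016Balls, Introduction §1.1] -/
theorem mdifferentiable_levelMap (hH : D₁.Hℂ = D₂.Hℂ)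
    (hΓ : D₁.Γ.map (Matrix.GeneralLinearGroup.map D₁.τ₁) ≤
      D₂.Γ.map (Matrix.GeneralLinearGroup.map D₂.τ₁))
    (𝔣 : D₂.SylvesterFrame) :
    MDifferentiable 𝓘(ℂ, A₁.model) 𝓘(ℂ, A₂.model) (levelMap D₁ D₂ A₁ A₂) := by
  intro x
  set 𝔣₁ := frameTransfer D₁ hH 𝔣 with h𝔣₁
  obtain ⟨z, hz⟩ := D₁.exists_modelUnif_eq A₁ 𝔣₁ x
  obtain ⟨c⟩ := D₁.nonempty_chartInverse A₁ 𝔣₁ z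
  set φ := extChartAt 𝓘(ℂ, A₁.model) x with hφ
  have hcenter : φ x ∈ c.W := by
    rw [hφ, ← hz]
    exact c.center_mem
  -- `levelMap = ψ₂ ∘ g ∘ φ` near `x`
  have key : levelMap D₁ D₂ A₁ A₂ =ᶠ[𝓝 x] fun x' ↦ D₂.modelUnif A₂ 𝔣 (c.g (φ x')) := by
    have h1 : ∀ᶠ x' in 𝓝 x, x' ∈ (chartAt A₁.model x).source :=
      (chartAt A₁.model x).open_source.mem_nhds (mem_chart_source _ x)
    have h2 : ∀ᶠ x' in 𝓝 x, φ x' ∈ c.W :=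
      (continuousAt_extChartAt (I := 𝓘(ℂ, A₁.model)) x).eventually (c.isOpen.mem_nhds hcenter)
    filter_upwards [h1, h2] with x' hx₁ hx₂
    have hsrc : x' ∈ φ.source := by rwa [hφ, extChartAt_source]
    have hx' : x' = D₁.modelUnif A₁ 𝔣₁ (c.g (φ x')) := by
      rw [← c.symm_eq (φ x') hx₂, hz]
      exact (φ.left_inv hsrc).symm
    have hball : c.g (φ x') ∈ BallForms.ballSet := c.mapsTo hx₂
    calc levelMap D₁ D₂ A₁ A₂ x'
        = levelMap D₁ D₂ A₁ A₂ (D₁.modelUnif A₁ 𝔣₁ (⟨c.g (φ x'), hball⟩ : Ball).1) :=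
          congrArg (levelMap D₁ D₂ A₁ A₂) hx'
      _ = D₂.modelUnif A₂ 𝔣 (⟨c.g (φ x'), hball⟩ : Ball).1 := levelMap_modelUnif hH hΓ 𝔣 _
  refine MDifferentiableAt.congr_of_eventuallyEq ?_ key
  have hφd : MDifferentiableAt 𝓘(ℂ, A₁.model) 𝓘(ℂ, A₁.model) φ x :=
    mdifferentiableAt_extChartAt (mem_chart_source _ x)
  have hg : MDifferentiableAt 𝓘(ℂ, A₁.model) 𝓘(ℂ, Fin 2 → ℂ) c.g (φ x) :=
    mdifferentiableAt_iff_differentiableAt.2 (c.differentiableAt hcenter)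
  have hψ : MDifferentiableAt 𝓘(ℂ, Fin 2 → ℂ) 𝓘(ℂ, A₂.model) (D₂.modelUnif A₂ 𝔣) (c.g (φ x)) :=
    (D₂.unifHolomorphic A₂ 𝔣).mdifferentiableAt
      (BallForms.isOpen_ballSet.mem_nhds (c.mapsTo hcenter))
  have hcomp : MDifferentiableAt 𝓘(ℂ, A₁.model) 𝓘(ℂ, A₂.model)
      (D₂.modelUnif A₂ 𝔣 ∘ (c.g ∘ φ)) x :=
    hψ.comp x (hg.comp x hφd)
  exact hcomp

/-! ### Algebraicity: the level covering is a morphism of the models -/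

/-- **The level covering is a morphism of the algebraic models** (under the record
`Arapura2012_Cor_15_4_6`: a holomorphic map between nonsingular projective varieties is a morphism):
for a level pair with the same hermitian space there is `g : X₁ ⟶ X₂` over `ℂ` with
`g(ℂ) (unif₁ v) = unif₂ v` on the cone. The Hodge models `A₁`, `A₂` (analytifications) are inputs;
the conclusion does not mention them. [cite: Arapura2012, §15.4 Cor. 15.4.6]
[cite: BergeronMillsonMoeglin2016Balls, Introduction §1.1] -/
theorem exists_hom_map_unif_eq (hA : Arapura2012_Cor_15_4_6) (hH : D₁.Hℂ = D₂.Hℂ)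
    (hΓ : D₁.Γ.map (Matrix.GeneralLinearGroup.map D₁.τ₁) ≤
      D₂.Γ.map (Matrix.GeneralLinearGroup.map D₂.τ₁))
    (A₁ : HodgeModel 2 X₁) (A₂ : HodgeModel 2 X₂) :
    ∃ g : X₁ ⟶ X₂, ∀ v ∈ D₁.cone, AlgPoints.map g (D₁.unif v) = D₂.unif v := by
  obtain ⟨𝔣⟩ := D₂.nonempty_sylvesterFrame
  obtain ⟨g, hg⟩ := hA X₁ X₂ D₁.isSmoothProjective D₂.isSmoothProjective A₁.model A₁.carrier
    A₁.toComplexPoints A₁.isAnalytification A₂.model A₂.carrier A₂.toComplexPoints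
    A₂.isAnalytification (levelMap D₁ D₂ A₁ A₂) (mdifferentiable_levelMap hH hΓ 𝔣)
  refine ⟨g, fun v hv ↦ ?_⟩
  have h := hg (A₁.isAnalytification.homeomorph.symm (D₁.unif v))
  rw [toComplexPoints_levelMap] at h
  have h' : A₁.toComplexPoints (A₁.isAnalytification.homeomorph.symm (D₁.unif v)) = D₁.unif v :=
    A₁.isAnalytification.homeomorph.apply_symm_apply _
  rw [h', levelPts_unif hH hΓ hv] at h
  exact h.symm

end HodgeCM.Model.LevelCovering

end
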